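import Mathlib
import Summits.MatrixMultiplication.MatrixMultiplication.Theses.SnSubsetDichotomy

/-!
Sketch for crux-idea cards on `HyperoctahedralSubsets` (stmt-MatrixMultiplication-8305).
First lemmas of the line `visibility-rank-spherical-vanishing` (statements only; they must elaborate).
-/

open scoped Pointwise Classical

namespace Summit.MatrixMultiplication.MatrixMultiplication.Cruxes.HyperoctahedralSubsets.Sketch

open Literature.Combinatorics.Additive

/-- Right quotient set `Q(X) = X X⁻¹`. -/
noncomputable def quot {G : Type*} [Group G] [DecidableEq G] (X : Finset G) : Finset G :=
  Finset.image₂ (fun x x' => x * x'⁻¹) X X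

/-- KEY REFORMULATION (provable now, pure algebra): TPP(S,T,U) iff `Q(T) ∩ Q(S)Q(U) = {1}` and
`Q(S) ∩ Q(U) = {1}` (TPP is invariant under all permutations of the three sets). -/
def TPPIffQuotient : Prop :=
  ∀ (G : Type) [Group G] [DecidableEq G] (S T U : Finset G), S.Nonempty → T.Nonempty → U.Nonempty →
    (TripleProductProperty S T U ↔
      ((quot T ∩ Finset.image₂ (· * ·) (quot S) (quot U) = {1}) ∧ (quot S ∩ quot U = {1})))

/-- VISIBILITY SUFFICIENCY (provable now): if `X i ⊆ C(μ i)`, `Q(X 0) ∩ Q(X 2) = {1}` and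
`Q(X 1)` meets the product set `C(μ 0)·C(μ 2)` only in `1`, then `(X 0, X 1, X 2)` has the TPP. -/
def VisibilitySufficient : Prop :=
  ∀ (n : ℕ) (μ : Fin 3 → Equiv.Perm (Fin n)) (X : Fin 3 → Finset (Equiv.Perm (Fin n))),
    (∀ i, ∀ σ ∈ X i, σ * μ i = μ i * σ) → (X 0).Nonempty → (X 1).Nonempty → (X 2).Nonempty →
    quot (X 0) ∩ quot (X 2) = {1} →
    (∀ q ∈ quot (X 1), q ∈ ((Subgroup.centralizer {μ 0} : Subgroup (Equiv.Perm (Fin n))) : Set (Equiv.Perm (Fin n))) *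
        ((Subgroup.centralizer {μ 2} : Subgroup (Equiv.Perm (Fin n))) : Set (Equiv.Perm (Fin n))) → q = 1) →
    TripleProductProperty (X 0) (X 1) (X 2)

/-- The visibility matrix of a pair of subgroups `H, K ≤ G`: `W x y = 1` iff `x y⁻¹ ∈ H·K`. -/
noncomputable def visMatrix {G : Type*} [Group G] [Fintype G] [DecidableEq G] (H K : Subgroup G) :
    Matrix G G ℚ :=
  Matrix.of fun x y => if x * y⁻¹ ∈ (H : Set G) * (K : Set G) then 1 else 0

/-- FIRST LEMMA — THE RANK LEVER (set-pair / induced-matching argument, provable now): a finite set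
`X` whose quotient set meets `H·K` only in `1` indexes an identity principal submatrix of the
visibility matrix, hence `|X| ≤ rank W(H,K)`; and `rank W(H,K) = Σ_ρ d_ρ · rk(P_ρ^H P_ρ^K)`. In
particular for a SUBGROUP triple `(K₀, K₁, K₂)` with the TPP, `|K₁| ≤ rank W(K₀, K₂)`. -/
def VisibilityRankBound : Prop :=
  ∀ (G : Type) [Group G] [Fintype G] [DecidableEq G] (H K : Subgroup G) (X : Finset G),
    (∀ x ∈ X, ∀ x' ∈ X, x * x'⁻¹ ∈ (H : Set G) * (K : Set G) → x = x') →
    X.card ≤ (visMatrix H K).rank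

/-- SPHERICAL VANISHING, numerical shadow (Macdonald 1995, VII.2 (2.4), (2.13), Ex. 2(c), Ex. 5):
for two fixed-point-free involutions whose matchings form a HAMILTONIAN 2-factor (i.e. `μ₀ μ₂` is a
product of two `n/2`-cycles) the visibility matrix of the two centralisers is the Hamiltonian class
matrix of the perfect-matching association scheme lifted to `S_n` (rows constant on left
`C(μ₀)`-cosets, columns on left `C(μ₂)`-cosets); its rank is `Σ_{λ ⊢ n/2, λ₃ ≤ 1} f^{2λ} ≤ 5^n`
(computed: `e^{1.32 n}` at `n = 200`, vs `(n-1)!! = e^{Θ(n log n)}`). -/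
def HamiltonianVisibleRank : Prop :=
  ∀ (n : ℕ) (μ₀ μ₂ : Equiv.Perm (Fin n)), μ₀ * μ₀ = 1 → μ₂ * μ₂ = 1 → (∀ x, μ₀ x ≠ x) →
    (∀ x, μ₂ x ≠ x) → (μ₀ * μ₂).cycleType = {n / 2, n / 2} →
    (((visMatrix (Subgroup.centralizer {μ₀}) (Subgroup.centralizer {μ₂})).rank : ℝ) ≤ (5 : ℝ) ^ n)

/-- CONSEQUENCE AIMED AT (the visibility-independent case of the crux in Hamiltonian position,
= VisibilityRankBound + HamiltonianVisibleRank): any `X₁` (inside `C(μ₁)` or not!) whose quotient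
set avoids `C(μ₀)C(μ₂) ∖ {1}` has `|X₁| ≤ 5^n` — versus `|C(μ₁)| = √(n!)(πn/2)^{1/4}`. -/
def HamiltonianIndependentSetsAreTiny : Prop :=
  ∀ (n : ℕ) (μ : Fin 3 → Equiv.Perm (Fin n)), (∀ i, μ i * μ i = 1 ∧ ∀ x, μ i x ≠ x) →
    (μ 0 * μ 2).cycleType = {n / 2, n / 2} →
    ∀ X₁ : Finset (Equiv.Perm (Fin n)), (∀ σ ∈ X₁, σ * μ 1 = μ 1 * σ) →
    (∀ x ∈ X₁, ∀ x' ∈ X₁, x * x'⁻¹ ∈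
        ((Subgroup.centralizer {μ 0} : Subgroup (Equiv.Perm (Fin n))) : Set (Equiv.Perm (Fin n))) *
        ((Subgroup.centralizer {μ 2} : Subgroup (Equiv.Perm (Fin n))) : Set (Equiv.Perm (Fin n))) → x = x') →
    (X₁.card : ℝ) ≤ (5 : ℝ) ^ n

end Summit.MatrixMultiplication.MatrixMultiplication.Cruxes.HyperoctahedralSubsets.Sketch
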